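import Summits.BirchSwinnertonDyer.BirchSwinnertonDyer.Theorems.GenusKolyvaginAtTwoShaCardDvdPowAtTwoRTPairSandwichSignFree
import Summits.BirchSwinnertonDyer.BirchSwinnertonDyer.Theorems.GenusKolyvaginAtTwoShaCardDvdPowAtTwoPosTOnCutRankQ
import Summits.BirchSwinnertonDyer.BirchSwinnertonDyer.Theorems.GenusKolyvaginAtTwoShaCardDvdPowAtTwoRTSharpExponentRat
import Literature.NumberTheory.EllipticCurves.SelmerGroupCardinality
import Literature.NumberTheory.EllipticCurves.BSDSelmerProofs
import HarnessLib

/-!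
# Route `GenusKolyvaginAtTwo`, crux U⁺_T `ShaCardDvdPowAtTwoPosT` (stmt-BirchSwinnertonDyer-23378, `Δ > 0`) and U_T′ (stmt-BirchSwinnertonDyer-23469,
# `Δ < 0`): THE UPPER HALF ON THE CUT FROM THE `ℚ`-SIDE SHARP EXPONENT — `#Ш(E/K)[2^∞] ∣ 4^(M₀)` on BOTH signs of `Δ`, with NO multiplicative
# prime and NO Kolyvagin descent over `K`, modulo the displayed B2Q-shape input `2^(M₀) · Ш(E/ℚ)[2^∞] = 0`

Seat `bsd-line-gk2-p3` g27 (PROVER seat 3/3, cell `bsd-f1-sign2`), `--supports stmt-BirchSwinnertonDyer-23378` (helper; closes nothing).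
THEOREMS ONLY (no definition, no named fact, no `sorry`); standard axioms.  BSD is NOT proved by any of this; U⁺_T / Q4_T AS FILED are NOT proved
(the `ℚ`-side exponent is a displayed hypothesis; off the cut nothing is claimed).

WHAT.  The sign-free pair sandwich (`…RTPairSandwichSignFree`) + the budgets + (RANKQ±) assembled in the currency of the route's items:

* §1 **`natCard_primaryComponent_sha_two_dvd_pow_onOddTwinCut_of_shaExponent`** (`Δ > 0`) — `W/ℚ` globally minimal, `C(W)` odd, `Δ_W > 0`,
  `ρ̄_{W,2}` onto; `K` imaginary quadratic, `d_K` odd, Heegner for `N_W`; a frame `(Dt, β, ι)` and a conductor-`1` datum `d₁` with `P(1)` of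
  infinite order and `2^(M₀+1) ∤ P(1)`; `w(E) = +1`; `rank E(ℚ) = 0`; an elliptic model `Wd ≅ E^(d_K)` with `#Sel₂(Wd) = 2` and `ord₂ C(Wd) = 0`
  (the TAMAGAWA-ODD `2`-Selmer-minimal twin); AND the `ℚ`-side sharp exponent «every `a ∈ Ш(E/ℚ)` of `2`-power order has `2^(M₀) a = 0`» (B2Q⁺:
  Kolyvagin's Theorem B₂ over `ℚ`; on `Δ > 0` = LINE 16_T's layer one with REGULAR Kolyvagin primes, gk2-p4 g23 / gk2-p5 g31 in flight) ⟹
  **`#Ш(E/K)[2^∞] ∣ 2^(2M₀)`** — the conclusion of U⁺_T.  This is the statement a restated U⁺_T′ (cut onto the live configuration, as R7-d did for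
  U_T) is closed by, the minute B2Q⁺ lands.
* §2 **`natCard_primaryComponent_sha_two_dvd_pow_onCut_of_shaExponent`** (`Δ < 0`) — the same on LINE 19's cut (`ord₂ C(Wd) ≤ 1`), from the SAME
  displayed exponent: LINE 19's U_T′ theorem with every K-side Kolyvagin input (`…_onHabitat`: FIN, `rank E(K) = 1`, the odd multiplicative prime)
  REMOVED — hence also the U-part of the additive-only residual `AdditiveOnlyResidualAtTwoNegDisc` (stmt-24826) reduces to B2Q without (D-NPh).
* §3 `natCard_primaryComponent_sha_two_dvd_pow_onCut_of_B2Q` — consistency: feeding gk2-p4 g22's B2Q (`two_pow_M0_smul_eq_zero_of_mem_sha_rat_onHabitat`,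
  odd multiplicative prime, `Δ < 0`) recovers LINE 19's on-cut theorem through the sign-free road (rank `E(ℚ) = 0` displayed).

Inside (both signs): `E(K)[2] = 0` (`ρ̄_{W,2}` onto); `y_K` anti-invariant up to torsion (Gross 5.3 = tree theorem, `w = 1`); `rank E(K) = rank E(ℚ) +
rank E^(d_K)(ℚ) = 0 + 1` (Mordell–Weil + `#Sel₂(Wd) = 2` + `y_K` of infinite order); `Ш(E^(d_K)/ℚ)[2^∞] = 0`; `Ш(E/ℚ)[2^∞] = Ш(E/ℚ)[2^(M₀)]` finite;
then `…RTPairSandwichSignFree.natCard_sha_dvd_pow_of_pair_of_frame` with the budget `…_of_padicValNat_eq_zero` (`Δ > 0`, archimedean bit) resp.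
`…_of_Δ_neg` and (RANKQ⁺) `…PosTOnCutRankQ` resp. (RANKQ) `…RTRankQ`.

HONEST FRAMING: no Kolyvagin argument is proved here; the file isolates EXACTLY what the `Δ > 0` upper half needs from LINE 16_T (one stub: the
`ℚ`-side sharp exponent with regular primes) and shows the rest is descent algebra already in the tree.  Beyond print: no.  BSD is NOT proved.

References: [Kramer1981] Thm. 1, §2 Prop. 3; [GrossLMS1991] §5 Prop. 5.3, (5.1)–(5.3); [MazurRubin2010] Cor. 3.4 (i); [Kolyvagin1989Izv] Thm. B₂;
[McCallumLMS1991] §5 Cor. 5.6; [SilvermanAEC2009] Thm. X.4.2, X.4.14, Exercise 10.16.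
-/

set_option autoImplicit false
set_option linter.dupNamespace false -- `Summit.<P>.<Sub>` repeats `BirchSwinnertonDyer` (D-0017)

noncomputable section

open scoped Classical

namespace Summit.BirchSwinnertonDyer.BirchSwinnertonDyer.Theorems.GenusExact.PlusDescent

open Literature.NumberTheory.EllipticCurves Literature.NumberTheory.GaloisRepresentations WeierstrassCurve NumberField
  IsDedekindDomain Field AddSubgroup Literature.NumberTheory.EllipticCurves.ModularForms
  Literature.NumberTheory.EllipticCurves.RingClassField
open Summit.BirchSwinnertonDyer.Rank1Residual
open Summit.BirchSwinnertonDyer.BirchSwinnertonDyer.Theses.GenusKolyvaginAtTwo (KolyvaginRelationAtTwo)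

variable (W : WeierstrassCurve ℚ) [W.IsElliptic] [W.IsGloballyMinimal] [NeZero (W.conductorNorm ℤ)]
variable (K : Type) [Field K] [NumberField K]

/-! ## §0 The frame inputs from the cut data (both signs) -/

/-- **The K-side frame from the cut data, sign-free.**  `ρ̄_{W,2}` onto, `K` imaginary quadratic with Heegner hypothesis, `τ ≠ 1`; a conductor-`1`
datum with `P(1)` of infinite order and `2^(M₀+1) ∤ P(1)`; `w(E) = +1`; `rank E(ℚ) = 0`; an elliptic model `Wd ≅ E^(d_K)` with `#Sel₂(Wd) = 2`.
Then: `E(K)[2] = 0`; `rank E(K) ≤ 1`; the Heegner point `y ∈ E(K)` under `P(1)` has `τy + y` torsion and `2^(M₀+1) ∤ y`; and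
`Ш(E^(d_K)/ℚ)[2^∞] = 0` (for the twist `W.quadraticTwist (discr K)` itself).  [cite: GrossLMS1991, §5 Prop. 5.3] [cite: SilvermanAEC2009, Thm. X.4.2,
Exercise 10.16] -/
theorem exists_frame_of_cut (hIQ : IsImaginaryQuadratic K) (hHe : SatisfiesHeegnerHypothesis (W.conductorNorm ℤ) K)
    (hs2 : W.HasSurjectiveModNGaloisRep 2) {τ : K ≃ₐ[ℚ] K} (hτ : τ ≠ 1)
    (Dt : ModularParametrizationData W (W.conductorNorm ℤ)) (β : ℤ) (ι : K →+* ℂ) (d₁ : KolyvaginHeegnerData Dt β ι 1)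
    (hy : ¬ IsOfFinAddOrder d₁.derivedPoint) (M₀ : ℕ)
    (hndiv : ¬ ∃ Q : (W.baseChange (ringClassField K ι 1)).toAffine.Point, ((2 ^ (M₀ + 1) : ℕ) : ℤ) • Q = d₁.derivedPoint)
    (hw : W.rootNumber = 1) (hrk0 : W.mordellWeilRank = 0)
    (Wd : WeierstrassCurve ℚ) [Wd.IsElliptic] (hWd : ∃ C : VariableChange ℚ, C • W.quadraticTwist (NumberField.discr K : ℚ) = Wd)
    (hSel : Nat.card (Wd.selmerGroup 2) = 2) :
    haveI := W.isElliptic_quadraticTwist (show (NumberField.discr K : ℚ) ≠ 0 by exact_mod_cast NumberField.discr_ne_zero K)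
    (∀ P : (W.baseChange K).toAffine.Point, (2 : ℤ) • P = 0 → P = 0) ∧
      (W.baseChange K).mordellWeilRank ≤ 1 ∧
      (∃ y : (W.baseChange K).toAffine.Point, (∀ Q : (W.baseChange K).toAffine.Point, ((2 ^ (M₀ + 1) : ℕ) : ℤ) • Q ≠ y) ∧
        IsOfFinAddOrder (Affine.Point.map (W' := W) (τ : K →ₐ[ℚ] K) y + y)) ∧
      (∀ x ∈ AddCommGroup.primaryComponent (↥(W.quadraticTwist (NumberField.discr K : ℚ)).sha) 2, x = 0) := by
  haveI : Fact (Nat.Prime 2) := ⟨Nat.prime_two⟩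
  haveI hell : (W.baseChange K).IsElliptic := inferInstanceAs ((W.map (algebraMap ℚ K)).IsElliptic)
  have h2 : Module.finrank ℚ K = 2 := hIQ.1
  have hdK : (NumberField.discr K : ℚ) ≠ 0 := by exact_mod_cast NumberField.discr_ne_zero K
  haveI hTell : (W.quadraticTwist (NumberField.discr K : ℚ)).IsElliptic := W.isElliptic_quadraticTwist hdK
  set T := W.quadraticTwist (NumberField.discr K : ℚ) with hTdef
  -- `E(K)[2] = 0`
  have h2tors : ∀ P : (W.baseChange K).toAffine.Point, (2 : ℤ) • P = 0 → P = 0 := fun P hP ↦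
    EigenClassesFinite.forall_zsmul_two_pow_baseChange_eq_zero_of_hasSurjectiveModNGaloisRep_two W K h2 hs2 1 P (by simpa using hP)
  -- the Heegner point `y` under `P(1)`, of infinite order, `2^(M₀+1) ∤ y`, `τy + y` torsion (Gross 5.3 with `w = 1`)
  obtain ⟨Ph, hPh, hPhmap⟩ := AdditiveKoly.exists_isHeegnerPoint_map_eq_derivedPoint_one (W := W) (K := K) (Dt := Dt) (β := β)
    (ι := ι) hIQ hHe d₁
  have hPhnt : ¬ IsOfFinAddOrder Ph := fun h ↦ hy (by rw [← hPhmap]; exact AddMonoidHom.isOfFinAddOrder _ h)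
  have hndiv' : ∀ Q : (W.baseChange K).toAffine.Point, ((2 ^ (M₀ + 1) : ℕ) : ℤ) • Q ≠ Ph :=
    forall_two_pow_smul_ne_bottom_of_not_dvd_derivedPoint d₁ Ph hPhmap le_rfl hndiv
  have hanti : IsOfFinAddOrder (Affine.Point.map (W' := W) (τ : K →ₐ[ℚ] K) Ph + Ph) := by
    have h := X11b.KolyvaginBottom.isOfFinAddOrder_map_sub_neg_rootNumber_smul (W := W) hIQ hHe hPh τ hτ
    rw [hw] at h
    simpa only [neg_smul, one_smul, sub_neg_eq_add] using h
  -- Mordell–Weil ranks: `rank E(K) = rank E(ℚ) + rank T(ℚ) = rank T(ℚ)`, `1 ≤ rank E(K)`, `rank T(ℚ) ≤ 1`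
  haveI : Module.Finite ℤ (W.baseChange K).toAffine.Point := (W.baseChange K).module_finite_point_holds
  have hsum : (W.baseChange K).mordellWeilRank = W.mordellWeilRank + T.mordellWeilRank :=
    W.mordellWeilRank_baseChange_of_finrank_eq_two_of_finite K h2
  have hK1 : 1 ≤ (W.baseChange K).mordellWeilRank :=
    one_le_mordellWeilRank_of_not_isOfFinAddOrder (W.baseChange K) inferInstance hPhnt
  -- `#Sel₂(T) = 2`
  obtain ⟨Cd, hCd⟩ := hWd
  have hSelT : Nat.card (T.selmerGroup 2) = 2 := by
    have h := natCard_selmerGroup_smul T Cd (n := 2) two_ne_zero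
    simp only [Nat.cast_ofNat] at h
    rw [← h, hCd, hSel]
  -- the descent count for `T`: `2 = 2^(rank T) · #T(ℚ)[2] · #(Ш ⊓ H¹[2])`
  have hcount := card_selmerGroup_eq_pow_rank_mul T 2
  simp only [Nat.cast_ofNat] at hcount
  rw [hSelT] at hcount
  have hrkT : T.mordellWeilRank ≤ 1 := by
    -- `2 = 2^rk · (a · b)` forces `2^rk ∣ 2`
    have hdvd : 2 ^ T.mordellWeilRank ∣ 2 := Dvd.intro _ (by rw [mul_assoc] at hcount; exact hcount.symm)
    have hle := Nat.le_of_dvd two_pos hdvd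
    by_contra h
    have h4 : 4 ≤ 2 ^ T.mordellWeilRank := by
      calc 4 = 2 ^ 2 := by norm_num
        _ ≤ 2 ^ T.mordellWeilRank := Nat.pow_le_pow_right (by norm_num) (by omega)
    omega
  have hrk : (W.baseChange K).mordellWeilRank ≤ 1 := by rw [hsum, hrk0, zero_add]; exact hrkT
  have hrkT1 : T.mordellWeilRank = 1 := by
    have : 1 ≤ T.mordellWeilRank := by rw [hsum, hrk0, zero_add] at hK1; exact hK1
    omega
  -- `#(Ш(T) ⊓ H¹[2]) = 1`, hence `Ш(T/ℚ)[2^∞] = 0`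
  rw [hrkT1, pow_one, mul_assoc] at hcount
  have hprod := Nat.eq_of_mul_eq_mul_left (show 0 < 2 by norm_num) ((mul_one 2).trans hcount)
  have h1 : Nat.card (T.sha ⊓ AddSubgroup.torsionBy T.galH1 (2 : ℤ) : AddSubgroup T.galH1) = 1 :=
    Nat.eq_one_of_mul_eq_one_left hprod.symm
  have hsub : Subsingleton (T.sha ⊓ AddSubgroup.torsionBy T.galH1 (2 : ℤ) : AddSubgroup T.galH1) := (Nat.card_eq_one_iff_unique.mp h1).1
  have hT0 : ∀ x ∈ AddCommGroup.primaryComponent (↥T.sha) 2, x = 0 := by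
    intro x hx
    by_contra hx0
    obtain ⟨k, hk⟩ := (AddCommGroup.mem_primaryComponent).1 hx
    obtain ⟨e, -, he⟩ := (Nat.dvd_prime_pow Nat.prime_two).mp (addOrderOf_dvd_iff_nsmul_eq_zero.mpr hk)
    have he1 : 1 ≤ e := by
      by_contra h
      have h0 : e = 0 := by omega
      rw [h0, pow_zero, AddMonoid.addOrderOf_eq_one_iff] at he
      exact hx0 he
    set y : T.sha := 2 ^ (e - 1) • x with hydef
    have hy2 : 2 • y = 0 := by
      rw [hydef, ← mul_nsmul', ← pow_succ', Nat.sub_add_cancel he1, ← he]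
      exact addOrderOf_nsmul_eq_zero x
    have hy0 : y ≠ 0 := by
      intro h
      have hdvd : addOrderOf x ∣ 2 ^ (e - 1) := addOrderOf_dvd_iff_nsmul_eq_zero.mpr (by rw [← hydef]; exact h)
      rw [he, Nat.pow_dvd_pow_iff_le_right (by norm_num)] at hdvd
      omega
    have hymem : ((y : T.sha) : T.galH1) ∈ (T.sha ⊓ AddSubgroup.torsionBy T.galH1 (2 : ℤ) : AddSubgroup T.galH1) := by
      refine AddSubgroup.mem_inf.mpr ⟨y.2, ?_⟩
      have h2y : (2 : ℤ) • ((y : T.sha) : T.galH1) = 0 := by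
        rw [show (2 : ℤ) = ((2 : ℕ) : ℤ) from rfl, natCast_zsmul, ← AddSubgroupClass.coe_nsmul, hy2, ZeroMemClass.coe_zero]
      exact mem_torsionBy_iff.mpr h2y
    have h0 : (⟨((y : T.sha) : T.galH1), hymem⟩ : (T.sha ⊓ AddSubgroup.torsionBy T.galH1 (2 : ℤ) : AddSubgroup T.galH1)) =
        ⟨0, AddSubgroup.zero_mem _⟩ := Subsingleton.elim _ _
    have hval : ((y : T.sha) : T.galH1) = 0 := congrArg Subtype.val h0
    exact hy0 (Subtype.ext hval)
  exact ⟨h2tors, hrk, ⟨Ph, hndiv', hanti⟩, hT0⟩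

omit [W.IsGloballyMinimal] [NeZero (W.conductorNorm ℤ)] in
/-- `Ш(E/ℚ)[2^∞]` is finite as soon as it has finite exponent (`= Ш(E/ℚ)[2^(M₀)]`, weak Mordell–Weil / Kummer sequence).
[cite: SilvermanAEC2009, Thm. X.4.2 (b)] -/
theorem finite_primaryComponent_sha_rat_two_of_exponent {M₀ : ℕ}
    (hexp : ∀ a ∈ AddCommGroup.primaryComponent (↥W.sha) 2, 2 ^ M₀ • a = 0) :
    Finite (AddCommGroup.primaryComponent (↥W.sha) 2) := by
  rw [primaryComponent_eq_torsionBy hexp]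
  exact W.finite_sha_torsionBy_holds ((2 ^ M₀ : ℕ) : ℤ) (by positivity)

omit [W.IsElliptic] [W.IsGloballyMinimal] [NeZero (W.conductorNorm ℤ)] in
/-- The B2Q-shape on `galH1` (`a ∈ Ш`, `2^k a = 0 ⟹ 2^(M₀) a = 0`, the conclusion shape of gk2-p4 g22's
`two_pow_M0_smul_eq_zero_of_mem_sha_rat_onHabitat`) read on the `2`-primary component of `↥Ш(E/ℚ)`. [folklore] -/
theorem forall_primaryComponent_sha_two_pow_smul_eq_zero_of_galH1 {M₀ : ℕ}
    (hB2Q : ∀ (k : ℕ) (a : W.galH1), a ∈ W.sha → ((2 ^ k : ℕ) : ℤ) • a = 0 → ((2 ^ M₀ : ℕ) : ℤ) • a = 0) :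
    ∀ a ∈ AddCommGroup.primaryComponent (↥W.sha) 2, 2 ^ M₀ • a = 0 := by
  intro a ha
  obtain ⟨k, hk⟩ := (AddCommGroup.mem_primaryComponent).mp ha
  have hk' : ((2 ^ k : ℕ) : ℤ) • (a : W.galH1) = 0 := by
    rw [natCast_zsmul, ← AddSubgroupClass.coe_nsmul, hk, ZeroMemClass.coe_zero]
  have h := hB2Q k (a : W.galH1) a.2 hk'
  rw [natCast_zsmul, ← AddSubgroupClass.coe_nsmul] at h
  exact_mod_cast h

/-! ## §0b `rank E(ℚ) = 0` from the Selmer-form exponent (Kummer) -/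

section RankZero

variable {F : Type} [Field F] [NumberField F] (V : WeierstrassCurve F) [V.IsElliptic]

/-- **A finitely generated abelian group in which `2^(M₀) A ⊆ 2^(M₀+1) A` has rank `0`** (counting `A/2^k A = 2^(k·rk) · #A[2^k]` at
`k = M₀, M₀ + 1`: the two quotients have the same order while the torsion factor can only grow). [folklore] -/
theorem finrank_eq_zero_of_pow_smul_le_pow_succ_smul {A : Type*} [AddCommGroup A] [Module.Finite ℤ A] {M₀ : ℕ}
    (h : ∀ a : A, ∃ b : A, ((2 ^ (M₀ + 1) : ℕ) : ℤ) • b = ((2 ^ M₀ : ℕ) : ℤ) • a) : Module.finrank ℤ A = 0 := by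
  set n₀ : ℕ := 2 ^ M₀ with hn₀
  set n₁ : ℕ := 2 ^ (M₀ + 1) with hn₁
  haveI : NeZero n₀ := ⟨by positivity⟩
  haveI : NeZero n₁ := ⟨by positivity⟩
  set R₀ := (zsmulAddGroupHom (α := A) (n₀ : ℤ)).range with hR₀
  set R₁ := (zsmulAddGroupHom (α := A) (n₁ : ℤ)).range with hR₁
  -- `2^(M₀+1) A ≤ 2^(M₀) A` and, by `h`, `2^(M₀) A ≤ 2^(M₀+1) A`
  have hle : R₁ = R₀ := by
    apply le_antisymm
    · rintro _ ⟨a, rfl⟩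
      refine ⟨(2 : ℤ) • a, ?_⟩
      have hc : ((n₀ : ℕ) : ℤ) * 2 = ((n₁ : ℕ) : ℤ) := by simp [hn₀, hn₁, pow_succ]
      change ((n₀ : ℕ) : ℤ) • ((2 : ℤ) • a) = ((n₁ : ℕ) : ℤ) • a
      rw [smul_smul, hc]
    · rintro _ ⟨a, rfl⟩
      obtain ⟨b, hb⟩ := h a
      exact ⟨b, by simpa only [zsmulAddGroupHom_apply] using hb⟩
  have h0 := natCard_quotient_range_zsmul_eq_pow_mul_card_torsionBy (A := A) n₀
  have h1 := natCard_quotient_range_zsmul_eq_pow_mul_card_torsionBy (A := A) n₁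
  have heq : Nat.card (A ⧸ R₁) = Nat.card (A ⧸ R₀) := by rw [hle]
  rw [← hR₀] at h0
  rw [← hR₁] at h1
  rw [h0, h1] at heq
  -- `A[2^M₀] ≤ A[2^(M₀+1)] ≤ A_tors`, finite
  haveI hTfin : Finite (AddCommGroup.torsion A) := by
    have hfin : Finite (Submodule.torsion ℤ A) :=
      Module.finite_of_fg_torsion (Submodule.torsion ℤ A) (Submodule.torsion_isTorsion)
    rw [← Submodule.torsion_int]
    exact hfin
  have hleT : torsionBy A (n₁ : ℤ) ≤ AddCommGroup.torsion A := fun a ha ↦ by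
    rw [mem_torsionBy_iff] at ha
    exact (AddCommGroup.mem_torsion a).mpr (isOfFinAddOrder_iff_zsmul_eq_zero.mpr ⟨n₁, by exact_mod_cast (NeZero.ne n₁), ha⟩)
  haveI : Finite (torsionBy A (n₁ : ℤ)) := Finite.of_injective _ (AddSubgroup.inclusion_injective hleT)
  have htors : Nat.card (torsionBy A n₀) ≤ Nat.card (torsionBy A n₁) := by
    refine AddSubgroup.card_le_of_le fun a ha ↦ ?_
    rw [mem_torsionBy_iff] at ha ⊢
    rw [hn₁, pow_succ, Nat.cast_mul, mul_comm, mul_smul, ← hn₀]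
    rw [ha, smul_zero]
  have hpos : 0 < Nat.card (torsionBy A n₁) := Nat.card_pos
  -- `2^((M₀+1)·rk) · #A[2^(M₀+1)] = 2^(M₀·rk) · #A[2^M₀] ≤ 2^(M₀·rk) · #A[2^(M₀+1)]`
  set r := Module.finrank ℤ A with hr
  have hineq : n₁ ^ r * Nat.card (torsionBy A n₁) ≤ n₀ ^ r * Nat.card (torsionBy A n₁) := by
    calc n₁ ^ r * Nat.card (torsionBy A n₁) = n₀ ^ r * Nat.card (torsionBy A n₀) := heq
      _ ≤ n₀ ^ r * Nat.card (torsionBy A n₁) := Nat.mul_le_mul_left _ htors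
  have hpow : n₁ ^ r ≤ n₀ ^ r := Nat.le_of_mul_le_mul_right hineq hpos
  by_contra hr0
  have hr1 : 1 ≤ r := Nat.one_le_iff_ne_zero.mpr hr0
  have hlt : n₀ ^ r < n₁ ^ r := by
    apply Nat.pow_lt_pow_left ?_ hr0
    rw [hn₀, hn₁, pow_succ]
    have : 0 < 2 ^ M₀ := by positivity
    omega
  omega

/-- **`rank E(F) = 0` from a uniform `2`-power exponent on the `2`-power Selmer groups**: if `2^(M₀)` kills `Sel_(2^(M₀+1))(E/F)` then
`rank E(F) = 0` (the Kummer map `E(F)/2^(M₀+1) ↪ Sel_(2^(M₀+1))`, tree `exists_kummerMap_holds`, and the count above).  This turns the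
Selmer-form conclusion of the `ℚ`-side sharp exponent (B2Q: `2^(M₀) · Sel_(2^M)(E/ℚ) = 0` for every `M`) into `rank E(ℚ) = 0`.
[cite: SilvermanAEC2009, §VIII.2 and Thm. X.4.2 (a)] -/
theorem mordellWeilRank_eq_zero_of_two_pow_smul_selmer_eq_zero {M₀ : ℕ}
    (hSel : ∀ s : galH1Torsion V ((2 ^ (M₀ + 1) : ℕ) : ℤ), s ∈ selmerGroup V ((2 ^ (M₀ + 1) : ℕ) : ℤ) → ((2 ^ M₀ : ℕ) : ℤ) • s = 0) :
    V.mordellWeilRank = 0 := by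
  haveI : Module.Finite ℤ V.toAffine.Point := V.module_finite_point_holds
  have hn : ((2 ^ (M₀ + 1) : ℕ) : ℤ) ≠ 0 := by positivity
  obtain ⟨κ, hker, hrange⟩ := V.exists_kummerMap_holds hn
  unfold WeierstrassCurve.mordellWeilRank
  refine finrank_eq_zero_of_pow_smul_le_pow_succ_smul (M₀ := M₀) fun P ↦ ?_
  -- `κ(2^M₀ P) = 2^M₀ κ(P) = 0`, so `2^M₀ P ∈ ker κ = 2^(M₀+1) E(F)`
  have hκP : κ P ∈ selmerGroup V ((2 ^ (M₀ + 1) : ℕ) : ℤ) := by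
    have : κ P ∈ κ.range := ⟨P, rfl⟩
    rw [hrange] at this
    exact (AddSubgroup.mem_inf.mp this).1
  have hmem : ((2 ^ M₀ : ℕ) : ℤ) • P ∈ κ.ker := by
    rw [AddMonoidHom.mem_ker, map_zsmul]
    exact hSel _ hκP
  rw [hker] at hmem
  obtain ⟨b, hb⟩ := hmem
  exact ⟨b, by simpa only [zsmulAddGroupHom_apply] using hb⟩

end RankZero

/-! ## §1 `Δ > 0`: the upper half on the Tamagawa-odd-twin cut from the `ℚ`-side sharp exponent -/

/-- **U⁺_T ON THE CUT FROM THE `ℚ`-SIDE SHARP EXPONENT (`Δ > 0`).**  `W/ℚ` globally minimal elliptic, `C(W)` odd, `Δ_W > 0`, `ρ̄_{W,2}` onto;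
`K` imaginary quadratic, `d_K` odd, Heegner for `N_W`; a frame `(Dt, β, ι)`, a conductor-`1` datum `d₁` with `P(1)` of infinite order and
`2^(M₀+1) ∤ P(1)`; `w(E) = +1`, `rank E(ℚ) = 0`; an elliptic `Wd ≅ E^(d_K)` with `#Sel₂(Wd) = 2` and `ord₂ C(Wd) = 0`; and (B2Q⁺, DISPLAYED) every
`a ∈ Ш(E/ℚ)` of `2`-power order has `2^(M₀) a = 0`.  Then **`#Ш(E/K)[2^∞] ∣ 2^(2M₀)`** — the conclusion of U⁺_T `ShaCardDvdPowAtTwoPosT`.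
NO odd multiplicative prime, NO Kolyvagin descent over `K`, NO `Ш`-finiteness input.  [cite: Kramer1981, Thm. 1, §2 Prop. 3] [cite: GrossLMS1991, §5]
[cite: MazurRubin2010, Cor. 3.4 (i)] [cite: Kolyvagin1989Izv, Thm. B₂] [cite: McCallumLMS1991, §5 Cor. 5.6] -/
theorem natCard_primaryComponent_sha_two_dvd_pow_onOddTwinCut_of_shaExponent (hT : Odd W.tamagawaProduct) (hpos : 0 < W.Δ)
    (hIQ : IsImaginaryQuadratic K) (hodd : Odd (NumberField.discr K)) (hHe : SatisfiesHeegnerHypothesis (W.conductorNorm ℤ) K)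
    (hs2 : W.HasSurjectiveModNGaloisRep 2)
    (Dt : ModularParametrizationData W (W.conductorNorm ℤ)) (β : ℤ) (ι : K →+* ℂ) (d₁ : KolyvaginHeegnerData Dt β ι 1)
    (hy : ¬ IsOfFinAddOrder d₁.derivedPoint) (M₀ : ℕ)
    (hndiv : ¬ ∃ Q : (W.baseChange (ringClassField K ι 1)).toAffine.Point, ((2 ^ (M₀ + 1) : ℕ) : ℤ) • Q = d₁.derivedPoint)
    (hw : W.rootNumber = 1) (hrk0 : W.mordellWeilRank = 0)
    (Wd : WeierstrassCurve ℚ) [Wd.IsElliptic] (hWd : ∃ C : VariableChange ℚ, C • W.quadraticTwist (NumberField.discr K : ℚ) = Wd)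
    (hSel : Nat.card (Wd.selmerGroup 2) = 2) (hDEF : padicValNat 2 Wd.tamagawaProduct = 0)
    (hB2Q : ∀ (k : ℕ) (a : W.galH1), a ∈ W.sha → ((2 ^ k : ℕ) : ℤ) • a = 0 → ((2 ^ M₀ : ℕ) : ℤ) • a = 0) :
    Nat.card (AddCommGroup.primaryComponent (W.baseChange K).sha 2) ∣ 2 ^ (2 * M₀) := by
  haveI : Fact (Nat.Prime 2) := ⟨Nat.prime_two⟩
  obtain ⟨τ, hτ, -⟩ := exists_conj_of_isImaginaryQuadratic (K := K) hIQ
  obtain ⟨h2tors, hrk, ⟨yK, hndiv', hanti⟩, hT0⟩ := exists_frame_of_cut W K hIQ hHe hs2 hτ Dt β ι d₁ hy M₀ hndiv hw hrk0 Wd hWd hSel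
  have hexp := forall_primaryComponent_sha_two_pow_smul_eq_zero_of_galH1 W hB2Q
  haveI := finite_primaryComponent_sha_rat_two_of_exponent W hexp
  obtain ⟨Cd, hCd⟩ := hWd
  obtain ⟨hne, hneT, hbudget⟩ := relIndex_mul_relIndex_le_four_of_padicValNat_eq_zero W K hIQ hodd hHe hT Cd hCd hDEF
  have h4 : Nat.card (AddSubgroup.torsionBy (↥W.sha) ((2 : ℕ) : ℤ)) ≤ 4 := by
    have h := natCard_sha_torsionBy_two_dvd_four_of_posDisc_of_padicValNat_eq_zero W hpos hT hIQ hodd hHe Wd ⟨Cd, hCd⟩ hDEF hSel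
    exact Nat.le_of_dvd (by norm_num) (by simpa using h)
  exact (natCard_sha_dvd_pow_of_pair_of_frame W K hIQ hτ h2tors hrk yK M₀ hndiv' hanti hT0 hne hneT hbudget hexp h4).2

/-- **U⁺_T ON THE CUT FROM B2Q⁺ IN SELMER FORM (`Δ > 0`)** — the same with the `ℚ`-side exponent in the SELMER currency
«`2^(M₀) · Sel_(2^M)(E/ℚ) = 0` for every `M`» (VERBATIM the conclusion shape of gk2-p4 g22's `two_pow_smul_selmer_rat_eq_zero_onHabitat` and of the
`Δ > 0` B2Q⁺ of gk2-p5 g31 / gk2-p4 g23): then `rank E(ℚ) = 0` (§0b, Kummer) and the `Ш`-form follow, so NO displayed input beyond B2Q⁺ remains.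
[cite: Kolyvagin1989Izv, Thm. B₂] [cite: Kramer1981, Thm. 1] [cite: MazurRubin2010, Cor. 3.4 (i)] [cite: SilvermanAEC2009, Thm. X.4.2 (a)] -/
theorem natCard_primaryComponent_sha_two_dvd_pow_onOddTwinCut_of_selmerExponent (hT : Odd W.tamagawaProduct) (hpos : 0 < W.Δ)
    (hIQ : IsImaginaryQuadratic K) (hodd : Odd (NumberField.discr K)) (hHe : SatisfiesHeegnerHypothesis (W.conductorNorm ℤ) K)
    (hs2 : W.HasSurjectiveModNGaloisRep 2)
    (Dt : ModularParametrizationData W (W.conductorNorm ℤ)) (β : ℤ) (ι : K →+* ℂ) (d₁ : KolyvaginHeegnerData Dt β ι 1)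
    (hy : ¬ IsOfFinAddOrder d₁.derivedPoint) (M₀ : ℕ)
    (hndiv : ¬ ∃ Q : (W.baseChange (ringClassField K ι 1)).toAffine.Point, ((2 ^ (M₀ + 1) : ℕ) : ℤ) • Q = d₁.derivedPoint)
    (hw : W.rootNumber = 1)
    (Wd : WeierstrassCurve ℚ) [Wd.IsElliptic] (hWd : ∃ C : VariableChange ℚ, C • W.quadraticTwist (NumberField.discr K : ℚ) = Wd)
    (hSel : Nat.card (Wd.selmerGroup 2) = 2) (hDEF : padicValNat 2 Wd.tamagawaProduct = 0)
    (hB2Q : ∀ (M : ℕ) (s : galH1Torsion W ((2 ^ M : ℕ) : ℤ)), s ∈ selmerGroup W ((2 ^ M : ℕ) : ℤ) → ((2 ^ M₀ : ℕ) : ℤ) • s = 0) :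
    Nat.card (AddCommGroup.primaryComponent (W.baseChange K).sha 2) ∣ 2 ^ (2 * M₀) := by
  have hrk0 : W.mordellWeilRank = 0 := mordellWeilRank_eq_zero_of_two_pow_smul_selmer_eq_zero W (hB2Q (M₀ + 1))
  refine natCard_primaryComponent_sha_two_dvd_pow_onOddTwinCut_of_shaExponent W K hT hpos hIQ hodd hHe hs2 Dt β ι d₁ hy M₀ hndiv hw hrk0 Wd hWd
    hSel hDEF (fun k a ha hka ↦ ?_)
  -- `Sel_(2^k) ↠ Ш ⊓ H¹[2^k]`
  rcases Nat.eq_zero_or_pos k with rfl | hkpos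
  · rw [pow_zero, Nat.cast_one, one_zsmul] at hka
    rw [hka, zsmul_zero]
  · have hn : ((2 ^ k : ℕ) : ℤ) ≠ 0 := by positivity
    have hmem : a ∈ W.sha ⊓ torsionBy W.galH1 ((2 ^ k : ℕ) : ℤ) :=
      AddSubgroup.mem_inf.mpr ⟨ha, by change ((2 ^ k : ℕ) : ℤ) • a = 0; exact hka⟩
    rw [← WeierstrassCurve.map_torsionH1ToH1_selmerGroup_holds W hn] at hmem
    obtain ⟨x, hx, rfl⟩ := AddSubgroup.mem_map.mp hmem
    rw [← map_zsmul, hB2Q k x hx, map_zero]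

/-! ## §2 `Δ < 0`: LINE 19's cut from the `ℚ`-side sharp exponent alone (no multiplicative prime, no K-side Kolyvagin) -/

/-- **U_T′ ON THE CUT FROM THE `ℚ`-SIDE SHARP EXPONENT (`Δ < 0`).**  Same as §1 with `Δ_W < 0` and `ord₂ C(Wd) ≤ 1` (LINE 19's cut; (RANKQ) of
gk2-p3 g26): **`#Ш(E/K)[2^∞] ∣ 2^(2M₀)`** from the displayed exponent — LINE 19's U_T′ theorem with the K-side Kolyvagin inputs removed; in
particular the U-part of the additive-only residual (stmt-BirchSwinnertonDyer-24826) reduces to B2Q WITHOUT an odd multiplicative prime.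
[cite: Kramer1981, Thm. 1, §2 Prop. 3] [cite: GrossLMS1991, §5] [cite: MazurRubin2010, Cor. 3.4 (i)] [cite: Kolyvagin1989Izv, Thm. B₂] -/
theorem natCard_primaryComponent_sha_two_dvd_pow_onCut_of_shaExponent (hT : Odd W.tamagawaProduct) (hneg : W.Δ < 0)
    (hIQ : IsImaginaryQuadratic K) (hodd : Odd (NumberField.discr K)) (hHe : SatisfiesHeegnerHypothesis (W.conductorNorm ℤ) K)
    (hs2 : W.HasSurjectiveModNGaloisRep 2)
    (Dt : ModularParametrizationData W (W.conductorNorm ℤ)) (β : ℤ) (ι : K →+* ℂ) (d₁ : KolyvaginHeegnerData Dt β ι 1)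
    (hy : ¬ IsOfFinAddOrder d₁.derivedPoint) (M₀ : ℕ)
    (hndiv : ¬ ∃ Q : (W.baseChange (ringClassField K ι 1)).toAffine.Point, ((2 ^ (M₀ + 1) : ℕ) : ℤ) • Q = d₁.derivedPoint)
    (hw : W.rootNumber = 1) (hrk0 : W.mordellWeilRank = 0)
    (Wd : WeierstrassCurve ℚ) [Wd.IsElliptic] (hWd : ∃ C : VariableChange ℚ, C • W.quadraticTwist (NumberField.discr K : ℚ) = Wd)
    (hSel : Nat.card (Wd.selmerGroup 2) = 2) (hDEF : padicValNat 2 Wd.tamagawaProduct ≤ 1)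
    (hB2Q : ∀ (k : ℕ) (a : W.galH1), a ∈ W.sha → ((2 ^ k : ℕ) : ℤ) • a = 0 → ((2 ^ M₀ : ℕ) : ℤ) • a = 0) :
    Nat.card (AddCommGroup.primaryComponent (W.baseChange K).sha 2) ∣ 2 ^ (2 * M₀) := by
  haveI : Fact (Nat.Prime 2) := ⟨Nat.prime_two⟩
  obtain ⟨τ, hτ, -⟩ := exists_conj_of_isImaginaryQuadratic (K := K) hIQ
  obtain ⟨h2tors, hrk, ⟨yK, hndiv', hanti⟩, hT0⟩ := exists_frame_of_cut W K hIQ hHe hs2 hτ Dt β ι d₁ hy M₀ hndiv hw hrk0 Wd hWd hSel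
  have hexp := forall_primaryComponent_sha_two_pow_smul_eq_zero_of_galH1 W hB2Q
  haveI := finite_primaryComponent_sha_rat_two_of_exponent W hexp
  obtain ⟨Cd, hCd⟩ := hWd
  obtain ⟨hne, hneT, hbudget⟩ := relIndex_mul_relIndex_le_four_of_Δ_neg W K hneg hIQ hodd hHe hT Cd hCd hDEF
  have h4 : Nat.card (AddSubgroup.torsionBy (↥W.sha) ((2 : ℕ) : ℤ)) ≤ 4 := by
    have h := natCard_sha_torsionBy_two_dvd_four_of_genusBudget_le_one_unramified W hneg hT hIQ hodd hHe Wd ⟨Cd, hCd⟩ hDEF hSel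
    exact Nat.le_of_dvd (by norm_num) (by simpa using h)
  exact (natCard_sha_dvd_pow_of_pair_of_frame W K hIQ hτ h2tors hrk yK M₀ hndiv' hanti hT0 hne hneT hbudget hexp h4).2

/-! ## §3 Consistency: LINE 19's on-cut theorem through the sign-free road -/

/-- **LINE 19's U_T′ on the cut, re-derived through the sign-free road** (gk2-p4 g22's B2Q `two_pow_M0_smul_eq_zero_of_mem_sha_rat_onHabitat`
supplies the exponent; `rank E(ℚ) = 0` displayed): same conclusion as the LEAD's `natCard_primaryComponent_sha_two_dvd_pow_onCut`.
[cite: Kolyvagin1989Izv, Thm. B₂] [cite: Kramer1981, Thm. 1] [cite: McCallumLMS1991, §5 Cor. 5.6] -/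
theorem natCard_primaryComponent_sha_two_dvd_pow_onCut_of_B2Q (hQ2 : KolyvaginRelationAtTwo) (hcm : ¬ W.HasCM)
    (hT : Odd W.tamagawaProduct) (v : HeightOneSpectrum (𝓞 ℚ)) (h2v : ((2 : ℕ) : 𝓞 ℚ) ∉ v.asIdeal)
    (hNv : ((W.conductorNorm ℤ : ℕ) : 𝓞 ℚ) ∈ v.asIdeal) (hmult : W.HasMultiplicativeReductionAt v) (hneg : W.Δ < 0)
    (hIQ : IsImaginaryQuadratic K) (hodd : Odd (NumberField.discr K))
    (h3 : NumberField.discr K ≠ -3) (hHe : SatisfiesHeegnerHypothesis (W.conductorNorm ℤ) K)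
    (hsq1 : ¬ IsSquare ((NumberField.discr K : ℚ) * -|W.Δ|)) (hsq2 : ¬ IsSquare ((NumberField.discr K : ℚ) * (-(2 * |W.Δ|))))
    (hρ : ∀ n : ℕ, 0 < n → W.HasSurjectiveModNGaloisRep ((2 : ℤ) ^ n))
    (Dt : ModularParametrizationData W (W.conductorNorm ℤ)) (β : ℤ) (ι : K →+* ℂ) (d₁ : KolyvaginHeegnerData Dt β ι 1)
    (hy : ¬ IsOfFinAddOrder d₁.derivedPoint) (M₀ : ℕ)
    (hndiv : ¬ ∃ Q : (W.baseChange (ringClassField K ι 1)).toAffine.Point, ((2 ^ (M₀ + 1) : ℕ) : ℤ) • Q = d₁.derivedPoint)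
    (hw : W.rootNumber = 1) (hrk0 : W.mordellWeilRank = 0) (Wd : WeierstrassCurve ℚ) [Wd.IsElliptic]
    (hWd : ∃ C : VariableChange ℚ, C • W.quadraticTwist (NumberField.discr K : ℚ) = Wd)
    (hSel : Nat.card (Wd.selmerGroup 2) = 2) (hDEF : padicValNat 2 Wd.tamagawaProduct ≤ 1) :
    Nat.card (AddCommGroup.primaryComponent (W.baseChange K).sha 2) ∣ 2 ^ (2 * M₀) :=
  natCard_primaryComponent_sha_two_dvd_pow_onCut_of_shaExponent W K hT hneg hIQ hodd hHe (by simpa using hρ 1 one_pos) Dt β ι d₁ hy M₀ hndiv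
    hw hrk0 Wd hWd hSel hDEF
    (fun k a ha hka ↦ two_pow_M0_smul_eq_zero_of_mem_sha_rat_onHabitat hQ2 W hcm hT v h2v hNv hmult hneg K hIQ hodd h3 hHe hsq1 hsq2 hρ Dt β ι
      d₁ M₀ hndiv hw k a ha hka)

end Summit.BirchSwinnertonDyer.BirchSwinnertonDyer.Theorems.GenusExact.PlusDescent

end
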